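import Summits.PneNP.PneNP.Theorems.ExpanderLinearGeneratorsMooreConfig

/-!
# A Moore-type bound for `(r, 6)`-boundary expanders with `8`-point scopes, II: exploration trees
(route ExpanderLinearGenerators, item stmt-PneNP-11442, helper file)

The binary EXPLORATION TREE of a boundaryless family inside its incidence graph (file I,
`ExpanderLinearGeneratorsMooreConfig`): nodes are bit strings `w : List Bool` (most recent step
first), labelled by a row `ρ w` and, for `w ≠ []`, by the point `φ w` through which the row was
entered. The tree is given abstractly by the local axioms it was grown with —

* `H1 : ρ w ∈ F`, `H2 : φ (c :: w) ∈ S (ρ w) ∩ S (ρ (c :: w))` (child rows are reached through a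
  point of the parent), `H3 : ρ (c :: w) ≠ ρ w`, `H4 : φ (false :: w) ≠ φ (true :: w)` (binary
  branching through two distinct points), `H5 : φ (c :: c' :: w) ≠ φ (c' :: w)` (no immediate
  return through the entry point) —

and this file derives what the two phases of the Moore argument use: a PATH in the incidence
graph from the root row to `ρ w` along the tree (`exists_treePath`, via `Walk.bypass`) whose
vertices and edges are tree vertices / tree edges of ancestors of `w`, and, under injectivity of
the labels up to a level (`ρ` on all nodes, `φ` on non-root nodes), the identification of its
second and penultimate vertices (`treePath_snd`, `treePath_penultimate`) and of the tree edges at a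
processed point (`eq_or_eq_cons_of_edge`). Plus two degree facts for subgraphs containing a cycle
or a path (`two_le_ncard_of_cycle`, `two_le_ncard_of_path_internal`).
-/

namespace Summit.PneNP.PneNP.Theorems

set_option linter.dupNamespace false -- `Summit.PneNP.PneNP.…`: summit = sub-problem (D-0017)

namespace MooreBound

open Finset SimpleGraph Literature.Computability.MetaComplexity

variable {ι : Type*} {S : ι → Finset ℕ} {F : Finset ι} {G : SimpleGraph (ι ⊕ ℕ)}

section Degrees

variable (hG : ∀ x y, G.Adj x y ↔ ∃ a v, a ∈ F ∧ v ∈ S a ∧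
  ((x = Sum.inl a ∧ y = Sum.inr v) ∨ (x = Sum.inr v ∧ y = Sum.inl a)))
include hG

/-- A vertex of a cycle contained in `C` has at least two `C`-neighbours. [folklore] -/
theorem two_le_ncard_of_cycle {C : G.Subgraph} {x : ι ⊕ ℕ} {Z : G.Walk x x} (hZ : Z.IsCycle)
    (hZC : Z.toSubgraph ≤ C) {y : ι ⊕ ℕ} (hy : y ∈ Z.support) : 2 ≤ (C.neighborSet y).ncard := by
  rw [← hZ.ncard_neighborSet_toSubgraph_eq_two hy]
  exact Set.ncard_le_ncard (Subgraph.neighborSet_subset_of_subgraph hZC y)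
    (finite_neighborSet_subgraph hG C y)

/-- An internal vertex of a path contained in `C` has at least two `C`-neighbours. [folklore] -/
theorem two_le_ncard_of_path_internal {C : G.Subgraph} {x x' : ι ⊕ ℕ} {P : G.Walk x x'}
    (hP : P.IsPath) (hPC : P.toSubgraph ≤ C) {y : ι ⊕ ℕ} (hy : y ∈ P.support) (hyx : y ≠ x)
    (hyx' : y ≠ x') : 2 ≤ (C.neighborSet y).ncard := by
  obtain ⟨i, hi, hil⟩ := Walk.mem_support_iff_exists_getVert.1 hy
  have hi0 : i ≠ 0 := by rintro rfl; exact hyx (by rw [← hi, Walk.getVert_zero])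
  have hil' : i < P.length := by
    rcases lt_or_eq_of_le hil with h | rfl
    · exact h
    · exact absurd (by rw [← hi, Walk.getVert_length]) hyx'
  rw [← hi, ← hP.ncard_neighborSet_toSubgraph_internal_eq_two hi0 hil']
  exact Set.ncard_le_ncard (Subgraph.neighborSet_subset_of_subgraph hPC _)
    (finite_neighborSet_subgraph hG C _)

end Degrees

/-! ### Tree paths -/

section Tree

variable (hG : ∀ x y, G.Adj x y ↔ ∃ a v, a ∈ F ∧ v ∈ S a ∧
  ((x = Sum.inl a ∧ y = Sum.inr v) ∨ (x = Sum.inr v ∧ y = Sum.inl a)))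
variable {ρ : List Bool → ι} {φ : List Bool → ℕ}
variable (H1 : ∀ w, ρ w ∈ F)
variable (H2 : ∀ c w, φ (c :: w) ∈ S (ρ w) ∧ φ (c :: w) ∈ S (ρ (c :: w)))

include hG H1 H2

/-- The tree edge from a row to the point of one of its children. [folklore] -/
theorem adj_parent (c : Bool) (w : List Bool) :
    G.Adj (Sum.inl (ρ w)) (Sum.inr (φ (c :: w))) :=
  (adj_inl_inr hG).2 ⟨H1 w, (H2 c w).1⟩

/-- The tree edge from the entry point of a child to the child row. [folklore] -/
theorem adj_child (c : Bool) (w : List Bool) :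
    G.Adj (Sum.inr (φ (c :: w))) (Sum.inl (ρ (c :: w))) :=
  (adj_inr_inl hG).2 ⟨H1 (c :: w), (H2 c w).2⟩

variable [DecidableEq ι]

/-- **Tree paths.** For every node `w` there is a path in the incidence graph from the root row
`ρ []` to `ρ w` whose vertices are the root or labels `ρ u`, `φ u` of non-root ancestors-or-self
`u` of `w` (suffixes of `w`), whose edges are tree edges `ρ u — φ (c :: u)` or
`φ (c :: u) — ρ (c :: u)` with `c :: u` a suffix of `w`, and whose length is at most `2 |w|`
(follow the tree and `bypass` repetitions). [folklore] -/
theorem exists_treePath (w : List Bool) :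
    ∃ P : G.Walk (Sum.inl (ρ [])) (Sum.inl (ρ w)), P.IsPath ∧
      (∀ x ∈ P.support, x = Sum.inl (ρ []) ∨
        ∃ u : List Bool, u ≠ [] ∧ u <:+ w ∧ (x = Sum.inl (ρ u) ∨ x = Sum.inr (φ u))) ∧
      (∀ e ∈ P.edges, ∃ (c : Bool) (u : List Bool), (c :: u) <:+ w ∧
        (e = s(Sum.inl (ρ u), Sum.inr (φ (c :: u))) ∨
          e = s(Sum.inr (φ (c :: u)), Sum.inl (ρ (c :: u))))) ∧
      P.length ≤ 2 * w.length := by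
  induction w with
  | nil =>
    refine ⟨Walk.nil, Walk.IsPath.nil, ?_, ?_, by simp⟩
    · intro x hx
      rw [Walk.support_nil, List.mem_singleton] at hx
      exact Or.inl hx
    · intro e he
      simp at he
  | cons c w ih =>
    obtain ⟨P, -, hsupp, hedges, hlen⟩ := ih
    set Q : G.Walk (Sum.inl (ρ [])) (Sum.inl (ρ (c :: w))) :=
      (P.concat (adj_parent hG H1 H2 c w)).concat (adj_child hG H1 H2 c w) with hQ
    refine ⟨Q.bypass, Q.bypass_isPath, ?_, ?_, ?_⟩
    · intro x hx
      have hx' := Q.support_bypass_subset_support hx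
      simp only [hQ, Walk.support_concat, List.mem_append, List.mem_singleton] at hx'
      rcases hx' with (hxP | rfl) | rfl
      · rcases hsupp x hxP with h | ⟨u, hu, huw, hxu⟩
        · exact Or.inl h
        · exact Or.inr ⟨u, hu, huw.trans (List.suffix_cons c w), hxu⟩
      · exact Or.inr ⟨c :: w, List.cons_ne_nil c w, List.suffix_refl _, Or.inr rfl⟩
      · exact Or.inr ⟨c :: w, List.cons_ne_nil c w, List.suffix_refl _, Or.inl rfl⟩
    · intro e he
      have he' := Q.edges_bypass_subset_edges he
      simp only [hQ, Walk.edges_concat, List.concat_eq_append, List.mem_append,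
        List.mem_singleton] at he'
      rcases he' with (heP | rfl) | rfl
      · obtain ⟨c', u, hu, h⟩ := hedges e heP
        exact ⟨c', u, hu.trans (List.suffix_cons c w), h⟩
      · exact ⟨c, w, List.suffix_refl _, Or.inl rfl⟩
      · exact ⟨c, w, List.suffix_refl _, Or.inr rfl⟩
    · calc Q.bypass.length ≤ Q.length := Q.length_bypass_le_length
        _ = P.length + 2 := by simp [hQ, Walk.length_concat]
        _ ≤ 2 * (c :: w).length := by rw [List.length_cons]; omega

omit [DecidableEq ι] hG H1 H2 in
/-- A point that is not the entry point of any non-root node of length `≤ n` does not lie on a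
walk whose vertices are tree vertices of ancestors of a node of length `≤ n`. [folklore] -/
theorem inr_notMem_support_of_fresh {n : ℕ} {w : List Bool} (hw : w.length ≤ n) {x x' : ι ⊕ ℕ}
    {P : G.Walk x x'}
    (hsupp : ∀ y ∈ P.support, y = Sum.inl (ρ []) ∨
      ∃ u : List Bool, u ≠ [] ∧ u <:+ w ∧ (y = Sum.inl (ρ u) ∨ y = Sum.inr (φ u)))
    {v : ℕ} (hv : ∀ u : List Bool, u ≠ [] → u.length ≤ n → φ u ≠ v) :
    Sum.inr v ∉ P.support := by
  intro hmem
  rcases hsupp _ hmem with h | ⟨u, hu, huw, h | h⟩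
  · exact Sum.inr_ne_inl h
  · exact Sum.inr_ne_inl h
  · exact hv u hu (huw.length_le.trans hw) (Sum.inr_injective h).symm

omit [DecidableEq ι] hG H1 H2 in
/-- A row that is not the label of any node of length `≤ n` does not lie on a walk whose vertices
are tree vertices of ancestors of a node of length `≤ n`. [folklore] -/
theorem inl_notMem_support_of_fresh {n : ℕ} {w : List Bool} (hw : w.length ≤ n) {x x' : ι ⊕ ℕ}
    {P : G.Walk x x'}
    (hsupp : ∀ y ∈ P.support, y = Sum.inl (ρ []) ∨
      ∃ u : List Bool, u ≠ [] ∧ u <:+ w ∧ (y = Sum.inl (ρ u) ∨ y = Sum.inr (φ u)))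
    {a : ι} (ha : ∀ u : List Bool, u.length ≤ n → ρ u ≠ a) :
    Sum.inl a ∉ P.support := by
  intro hmem
  rcases hsupp _ hmem with h | ⟨u, -, huw, h | h⟩
  · exact ha [] (by simp) (Sum.inl_injective h).symm
  · exact ha u (huw.length_le.trans hw) (Sum.inl_injective h).symm
  · exact Sum.inl_ne_inr h

omit [DecidableEq ι] hG H1 H2 in
/-- **Tree edges at a processed point.** Under injectivity of the labels up to level `n`, a tree
edge (along ancestors of a node `w` of level `≤ n`) joining the entry point `φ z` of a node `z` of
level `≤ n` to the row `ρ w` forces `z = w` or `z` to be a child of `w`. [folklore] -/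
theorem eq_or_eq_cons_of_edge {n : ℕ}
    (hIR : ∀ u u' : List Bool, u.length ≤ n → u'.length ≤ n → ρ u = ρ u' → u = u')
    (hIP : ∀ u u' : List Bool, u ≠ [] → u' ≠ [] → u.length ≤ n → u'.length ≤ n →
      φ u = φ u' → u = u')
    {w w' z : List Bool} (hw : w.length ≤ n) (hw' : w'.length ≤ n) (hz : z ≠ [])
    (hzn : z.length ≤ n) {e : Sym2 (ι ⊕ ℕ)}
    (he : ∃ (c : Bool) (u : List Bool), (c :: u) <:+ w' ∧
      (e = s(Sum.inl (ρ u), Sum.inr (φ (c :: u))) ∨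
        e = s(Sum.inr (φ (c :: u)), Sum.inl (ρ (c :: u)))))
    (heq : e = s(Sum.inr (φ z), Sum.inl (ρ w))) : z = w ∨ ∃ c, z = c :: w := by
  obtain ⟨c, u, hu, h | h⟩ := he
  · rw [h, Sym2.eq_iff] at heq
    have hcu : (c :: u).length ≤ n := hu.length_le.trans hw'
    have hu' : u.length ≤ n := by simp at hcu; omega
    rcases heq with ⟨h1, -⟩ | ⟨h1, h2⟩
    · exact absurd h1 Sum.inl_ne_inr
    · have e1 : z = c :: u :=
        hIP z (c :: u) hz (List.cons_ne_nil c u) hzn hcu (Sum.inr_injective h2).symm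
      have e2 : w = u := hIR w u hw hu' (Sum.inl_injective h1).symm
      exact Or.inr ⟨c, by rw [e1, e2]⟩
  · rw [h, Sym2.eq_iff] at heq
    have hcu : (c :: u).length ≤ n := hu.length_le.trans hw'
    rcases heq with ⟨h1, h2⟩ | ⟨h1, -⟩
    · have e1 : z = c :: u :=
        hIP z (c :: u) hz (List.cons_ne_nil c u) hzn hcu (Sum.inr_injective h1).symm
      have e2 : w = c :: u := hIR w (c :: u) hw hcu (Sum.inl_injective h2).symm
      exact Or.inl (e1.trans e2.symm)
    · exact absurd h1 Sum.inr_ne_inl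

omit [DecidableEq ι] hG H1 H2 in
/-- **The second vertex of a tree path** from the root to a non-root node is the entry point of a
child of the root (under injectivity of `ρ` up to the level of the node). [folklore] -/
theorem treePath_snd {n : ℕ}
    (hIR : ∀ u u' : List Bool, u.length ≤ n → u'.length ≤ n → ρ u = ρ u' → u = u')
    {w : List Bool} (hw : w.length ≤ n) (hwne : w ≠ [])
    {P : G.Walk (Sum.inl (ρ [])) (Sum.inl (ρ w))}
    (hedges : ∀ e ∈ P.edges, ∃ (c : Bool) (u : List Bool), (c :: u) <:+ w ∧
      (e = s(Sum.inl (ρ u), Sum.inr (φ (c :: u))) ∨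
        e = s(Sum.inr (φ (c :: u)), Sum.inl (ρ (c :: u))))) :
    ∃ c, P.snd = Sum.inr (φ [c]) := by
  have hnil : ¬ P.Nil := Walk.not_nil_of_ne fun h =>
    hwne (hIR w [] hw (by simp) (Sum.inl_injective h).symm)
  have hmem : s(Sum.inl (ρ []), P.snd) ∈ P.edges :=
    Walk.adj_toSubgraph_iff_mem_edges.1 (P.toSubgraph_adj_snd hnil)
  obtain ⟨c, u, hu, h | h⟩ := hedges _ hmem
  · rw [Sym2.eq_iff] at h
    rcases h with ⟨h1, h2⟩ | ⟨h1, -⟩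
    · have hcu : (c :: u).length ≤ n := hu.length_le.trans hw
      have hun : u.length ≤ n := by simp at hcu; omega
      have : [] = u := hIR [] u (by simp) hun (Sum.inl_injective h1)
      subst this
      exact ⟨c, h2⟩
    · exact absurd h1 Sum.inl_ne_inr
  · rw [Sym2.eq_iff] at h
    rcases h with ⟨h1, -⟩ | ⟨h1, -⟩
    · exact absurd h1 Sum.inl_ne_inr
    · have hcu : (c :: u).length ≤ n := hu.length_le.trans hw
      have : [] = c :: u := hIR [] (c :: u) (by simp) hcu (Sum.inl_injective h1)
      exact absurd this.symm (List.cons_ne_nil c u)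

omit [DecidableEq ι] hG H1 H2 in
/-- **The penultimate vertex of a tree path** from the root to a non-root node `w` is the entry
point `φ w` (under injectivity of `ρ` up to the level of `w`). [folklore] -/
theorem treePath_penultimate {n : ℕ}
    (hIR : ∀ u u' : List Bool, u.length ≤ n → u'.length ≤ n → ρ u = ρ u' → u = u')
    {w : List Bool} (hw : w.length ≤ n) (hwne : w ≠ [])
    {P : G.Walk (Sum.inl (ρ [])) (Sum.inl (ρ w))}
    (hedges : ∀ e ∈ P.edges, ∃ (c : Bool) (u : List Bool), (c :: u) <:+ w ∧
      (e = s(Sum.inl (ρ u), Sum.inr (φ (c :: u))) ∨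
        e = s(Sum.inr (φ (c :: u)), Sum.inl (ρ (c :: u))))) :
    P.penultimate = Sum.inr (φ w) := by
  have hnil : ¬ P.Nil := Walk.not_nil_of_ne fun h =>
    hwne (hIR w [] hw (by simp) (Sum.inl_injective h).symm)
  have hmem : s(P.penultimate, Sum.inl (ρ w)) ∈ P.edges :=
    Walk.adj_toSubgraph_iff_mem_edges.1 (P.toSubgraph_adj_penultimate hnil)
  obtain ⟨c, u, hu, h | h⟩ := hedges _ hmem
  · rw [Sym2.eq_iff] at h
    rcases h with ⟨-, h2⟩ | ⟨h1, h2⟩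
    · exact absurd h2 Sum.inl_ne_inr
    · have hcu : (c :: u).length ≤ n := hu.length_le.trans hw
      have hun : u.length ≤ n := (Nat.le_succ _).trans (by simpa using hcu)
      have : w = u := hIR w u hw hun (Sum.inl_injective h2)
      subst this
      have := hu.length_le
      simp at this
  · rw [Sym2.eq_iff] at h
    rcases h with ⟨h1, h2⟩ | ⟨-, h2⟩
    · have hcu : (c :: u).length ≤ n := hu.length_le.trans hw
      have : w = c :: u := hIR w (c :: u) hw hcu (Sum.inl_injective h2)
      subst this
      exact h1
    · exact absurd h2 Sum.inl_ne_inr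

end Tree

end MooreBound

end Summit.PneNP.PneNP.Theorems
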